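import Literature.Topology.Immersions.LinearRemodel
import Literature.Topology.Immersions.OpenParallelizableImmersionHolds
import HarnessLib

/-!
# Hirsch's immersion theorem, trivial normal bundle: if `M × ℝᵏ` is parallelizable then `M` immerses in `ℝⁿ⁺ᵏ`

Topic `Literature/Topology/Immersions`. M. W. Hirsch, *Immersions of manifolds*, Trans. Amer.
Math. Soc. 93 (1959), 242–276, Thm. 6.3 / Cor. 6.4: a manifold `Mⁿ` immerses in `ℝⁿ⁺ᵏ` (`k ≥ 1`)
with trivial normal bundle iff `TM ⊕ εᵏ` is trivial, i.e. iff `M × ℝᵏ` is parallelizable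
(Kirby, *The Topology of 4-Manifolds* (1989), Ch. VI, proof of Lemma 1 ("τ ⊕ ν is trivial … so
`M` immerses", citing Hirsch) and Cor. 2: a spin `M⁴` with `p₁ = 0` immerses in `ℝ⁶` with trivial
normal bundle). We **prove the "if" direction from the tree's Phillips–Gromov theorem**
`Literature.Topology.Immersions.Phillips1967_exists_isLocalDiffeomorph_of_isParallelizable_holds`
(every open parallelizable `m`-manifold admits a `C^∞` local diffeomorphism into `ℝᵐ`; discharged
in `OpenParallelizableImmersionHolds.lean`): `M × ℝᵏ` is an open `(n + k)`-manifold (no compact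
component, `k ≥ 1`), so it admits a local diffeomorphism `F : M × ℝᵏ → ℝⁿ⁺ᵏ`, and
`x ↦ F (x, 0)` is an immersion of `M` (`exists_immersion_of_isParallelizable_prod`) — indeed one
whose normal bundle is framed by `∂F/∂v`, which we do not record.

The only work is bookkeeping: Phillips' theorem is stated for manifolds charted on
`EuclideanSpace ℝ (Fin m)` while Mathlib charts `M × ℝᵏ` on `ModelProd ℝⁿ ℝᵏ`; the change of
model is the tree's `Literature.Topology.Immersions.Remodel` (`LinearRemodel.lean`) along the
linear isomorphism `ℝⁿ × ℝᵏ ≃L ℝⁿ⁺ᵏ`, which preserves `C^∞` maps, differentials up to that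
isomorphism, and parallelizations.

Everything here is proved; no named facts are introduced (D-0026).

## References

* M. W. Hirsch, *Immersions of manifolds*, Trans. Amer. Math. Soc. 93 (1959), 242–276, §6
  (Thm. 6.3, Cor. 6.4). [Hirsch1959]
* A. Phillips, *Submersions of open manifolds*, Topology 6 (1967), 171–206, Cor. 8.2. [Phillips1967]
* R. C. Kirby, *The Topology of 4-Manifolds*, LNM 1374 (1989), Ch. VI, Lemma 1 and Cor. 2.
  [Kirby1989]
-/

open scoped Manifold ContDiff Topology
open Set Function Module

noncomputable section

namespace Literature.Topology.Immersions

/-- Local notation: `𝔼 n` is the model Euclidean space `EuclideanSpace ℝ (Fin n)`. -/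
local notation "𝔼 " n:arg => EuclideanSpace ℝ (Fin n)

open Literature.Topology.FourManifolds (IsParallelizable)

variable {n k : ℕ}

/-- The linear change of model `ℝⁿ × ℝᵏ ≃L ℝⁿ⁺ᵏ` (dimension count). [folklore] -/
def prodModelLin (n k : ℕ) : (𝔼 n × 𝔼 k) ≃L[ℝ] 𝔼 (n + k) :=
  ContinuousLinearEquiv.ofFinrankEq (by simp [Module.finrank_prod])

/-- **`M × ℝᵏ` re-charted on `ℝⁿ⁺ᵏ`** (tree's `Remodel` of the product manifold along
`prodModelLin`). [folklore] -/
abbrev EuclProd (n k : ℕ) (M : Type*) [TopologicalSpace M] [ChartedSpace (𝔼 n) M] : Type _ :=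
  Remodel ((𝓡 n).prod (𝓡 k)) (prodModelLin n k) (M × 𝔼 k)

/-- **`M × ℝᵏ` (`k ≥ 1`) is an open manifold**: none of its connected components is compact (each
contains a closed copy `{x} × ℝᵏ` of the non-compact `ℝᵏ`). [folklore] -/
theorem not_isCompact_connectedComponent_prod (hk : 1 ≤ k) {M : Type*} [TopologicalSpace M]
    [T2Space M] (p : M × 𝔼 k) : ¬IsCompact (connectedComponent p) := by
  intro hc
  -- the slice `{p.1} × ℝᵏ` is connected, contains `p`, hence lies in the component
  have hsub : (fun v : 𝔼 k => (p.1, v)) '' univ ⊆ connectedComponent p := by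
    have hconn : IsConnected ((fun v : 𝔼 k => (p.1, v)) '' univ) :=
      isConnected_univ.image _ (by fun_prop : Continuous fun v : 𝔼 k => (p.1, v)).continuousOn
    have hp : p ∈ (fun v : 𝔼 k => (p.1, v)) '' univ := ⟨p.2, mem_univ _, rfl⟩
    exact hconn.2.subset_connectedComponent hp
  -- it is closed, hence compact, hence `ℝᵏ` is compact: contradiction
  have hclosed : IsClosed ((fun v : 𝔼 k => (p.1, v)) '' univ) := by
    rw [image_univ, show range (fun v : 𝔼 k => (p.1, v)) = Prod.fst ⁻¹' {p.1} by
      ext q; constructor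
      · rintro ⟨v, rfl⟩; rfl
      · intro hq; exact ⟨q.2, Prod.ext hq.symm rfl⟩]
    exact (isClosed_singleton).preimage continuous_fst
  have hK : IsCompact ((fun v : 𝔼 k => (p.1, v)) '' univ) := hc.of_isClosed_subset hclosed hsub
  have hK' : IsCompact (univ : Set (𝔼 k)) := by
    have himage : Prod.snd '' ((fun v : 𝔼 k => (p.1, v)) '' univ) = univ := by
      rw [image_image]; simp
    rw [← himage]
    exact hK.image continuous_snd
  haveI : Nontrivial (𝔼 k) := by
    have : 0 < Module.finrank ℝ (𝔼 k) := by rw [finrank_euclideanSpace_fin]; omega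
    exact Module.nontrivial_of_finrank_pos this
  exact noncompact_univ (𝔼 k) hK'

/-- **Hirsch's theorem (trivial normal bundle, from Phillips)**: if `M × ℝᵏ` is parallelizable for
some `k ≥ 1` — equivalently `TM ⊕ εᵏ` is trivial — then the `n`-manifold `M` (Hausdorff, second
countable, not necessarily compact) admits a `C^∞` immersion into `ℝⁿ⁺ᵏ`: a smooth map with
everywhere injective differential. [cite: Hirsch1959, Thm. 6.3; Phillips1967, Cor. 8.2] -/
theorem exists_immersion_of_isParallelizable_prod (hk : 1 ≤ k) {M : Type} [TopologicalSpace M]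
    [T2Space M] [SecondCountableTopology M] [ChartedSpace (𝔼 n) M] [IsManifold (𝓡 n) ∞ M]
    (h : IsParallelizable ((𝓡 n).prod (𝓡 k)) (M × 𝔼 k)) :
    ∃ g : M → 𝔼 (n + k), ContMDiff (𝓡 n) (𝓡 (n + k)) ∞ g ∧
      ∀ x, Injective (mfderiv (𝓡 n) (𝓡 (n + k)) g x) := by
  -- `M × ℝᵏ` re-charted on `ℝⁿ⁺ᵏ`: open and parallelizable
  have hpar : IsParallelizable (𝓡 (n + k)) (EuclProd n k M) :=
    Remodel.isParallelizable_remodel ((𝓡 n).prod (𝓡 k)) (prodModelLin n k) h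
  have hopen : ∀ p : EuclProd n k M, ¬IsCompact (connectedComponent p) := fun p =>
    not_isCompact_connectedComponent_prod hk (M := M) p
  -- Phillips: a local diffeomorphism `G : M × ℝᵏ → ℝⁿ⁺ᵏ`
  obtain ⟨G, hG⟩ := Phillips1967_exists_isLocalDiffeomorph_of_isParallelizable_holds (n + k)
    (EuclProd n k M) hopen hpar
  set F : M × 𝔼 k → 𝔼 (n + k) := G ∘ Remodel.toRemodel ((𝓡 n).prod (𝓡 k)) (prodModelLin n k) (M × 𝔼 k)
    with hF
  have hGs : ContMDiff (𝓡 (n + k)) (𝓡 (n + k)) ∞ G := hG.contMDiff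
  have hto := Remodel.contMDiff_toRemodel ((𝓡 n).prod (𝓡 k)) (prodModelLin n k) (M := M × 𝔼 k) (n := ∞)
  have hFs : ContMDiff ((𝓡 n).prod (𝓡 k)) (𝓡 (n + k)) ∞ F := hGs.comp hto
  have hFinj : ∀ p, Injective (mfderiv ((𝓡 n).prod (𝓡 k)) (𝓡 (n + k)) F p) := by
    intro p
    rw [hF, mfderiv_comp p ((hGs _).mdifferentiableAt (by simp)) ((hto p).mdifferentiableAt (by simp))]
    have h1 : Injective (mfderiv (𝓡 (n + k)) (𝓡 (n + k)) G
        (Remodel.toRemodel ((𝓡 n).prod (𝓡 k)) (prodModelLin n k) (M × 𝔼 k) p)) := by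
      exact ((hG (Remodel.toRemodel ((𝓡 n).prod (𝓡 k)) (prodModelLin n k) (M × 𝔼 k) p)).mfderivToContinuousLinearEquiv
        (by simp)).injective
    exact h1.comp (Remodel.bijective_mfderiv_toRemodel ((𝓡 n).prod (𝓡 k)) (prodModelLin n k)
      (n := ∞) (by simp) p).1
  -- the immersion `x ↦ F (x, 0)`
  have hι : ContMDiff (𝓡 n) ((𝓡 n).prod (𝓡 k)) ∞ fun x : M => (x, (0 : 𝔼 k)) :=
    contMDiff_id.prodMk contMDiff_const
  refine ⟨fun x => F (x, 0), hFs.comp hι, fun x => ?_⟩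
  have hcomp : (fun x => F (x, 0)) = F ∘ fun x : M => (x, (0 : 𝔼 k)) := rfl
  rw [hcomp, mfderiv_comp x ((hFs _).mdifferentiableAt (by simp)) ((hι x).mdifferentiableAt (by simp)),
    mfderiv_prod_left]
  exact (hFinj (x, 0)).comp fun v w hvw => LinearMap.inl_injective hvw

end Literature.Topology.Immersions
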